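import Mathlib.Data.Fintype.Card
import Mathlib.Data.Fintype.Powerset
import Mathlib.Data.Finset.Card
import Mathlib.GroupTheory.Perm.Basic
import Literature.NumberTheory.LFunctions.AutomaticSequenceAutomata
import HarnessLib

/-!
# Müllner's naturally induced transducer: minimal images, their permutations, and the reconstruction of the automaton (proved)

Everything in this file is PROVED (plus plain definitions). It formalises §2.1–2.2 of
C. Müllner, *Automatic sequences fulfill the Sarnak conjecture* (Duke Math. J. 166 (2017)) — the
"naturally induced transducer" `T_A` of a finite automaton `A = (σ, δ)` — in a subset formulation
that avoids ordered tuples: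

* `wordAct δ w` — the action `q ↦ δ(q, w)` of a word; `fullImage δ w = δ(σ, w)`;
  `minRank δ = n₀(A) = min_w |δ(σ, w)|` and `minImages δ = S(A)`, the images of size `n₀(A)`
  (proof of Prop. 2.2). Key facts: a minimal image is mapped by every word BIJECTIVELY onto a
  minimal image (`image_mem_minImages`, `injOn_wordAct`); a word `w₀` realising the minimum is
  SYNCHRONIZING for the transducer (`image_eq_fullImage_of_card`: `δ(M, w₀) = δ(σ, w₀)` for all
  `M ∈ S(A)`); the transducer is strongly connected (`exists_image_eq`); and when `A` is strongly
  connected every state lies in a minimal image (`exists_mem_minImages_mem`, "`Q'` is covered by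
  `S(A)`").
* `MinImage δ` — the state set `Q = S(A)` of `T_A`; `MinImage.next M w = δ(M, w)`;
  `MinImage.enum M : M ≃ Fin n₀` (Müllner's ordering of the tuple `q_M`);
  `MinImage.T M w ∈ Perm (Fin n₀)` — the transducer output `T(q_M, w)` (the bijection
  `δ(·, w) : M → δ(M, w)` read through the enumerations); multiplicativity
  `T(M, v w) = T(M, v) · T(δ(M, v), w)` (`MinImage.T_append`, Müllner's
  `T(q, w₁w₂) = T(q,w₁) ∘ T(δ(q,w₁), w₂)`), and the RECONSTRUCTION of the automaton from the
  transducer (`MinImage.wordAct_eq`, Prop. 2.5: `δ'(q', w) = π₁(T(q, w) · δ(q, w))`): for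
  `q' ∈ M`, `δ(q', w) = enum_{δ(M,w)}⁻¹ (T(M, w) (enum_M q'))`.

The alphabet is all of `ℕ` (only finiteness of `σ` matters; for a base-`k` automaton one first
makes non-digits act trivially). Properties 5)–6) of Def. 2.1 (minimality of the presentation)
and the group-theoretic structure theorems Thm. 2.7 (`d(A)`, `G`) and Thm. 2.16 (`k₀(A)`) are NOT
formalised here.

## References
* C. Müllner, Duke Math. J. 166 (2017), §2.1 (Def. 2.1, Prop. 2.2, Lemma 2.3), §2.2 (Lemma 2.4,
  Prop. 2.5, Prop. 2.6). [Mullner2017]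
-/

noncomputable section

open Finset

namespace Literature.NumberTheory.LFunctions

section WordAct

variable {σ : Type*}

/-- The action of a word on the states, read from left to right: `wordAct δ w q = δ(q, w)`.
[cite: Mullner2017, Def. 1.4] -/
def wordAct (δ : σ → ℕ → σ) (w : List ℕ) (q : σ) : σ :=
  w.foldl δ q

/-- Unfolding. [folklore] -/
theorem wordAct_def (δ : σ → ℕ → σ) (w : List ℕ) (q : σ) : wordAct δ w q = w.foldl δ q := rfl

/-- The empty word acts trivially. [folklore] -/
@[simp] theorem wordAct_nil (δ : σ → ℕ → σ) (q : σ) : wordAct δ [] q = q := rfl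

/-- `δ(q, v w) = δ(δ(q, v), w)`. [cite: Mullner2017, Def. 1.4] -/
theorem wordAct_append (δ : σ → ℕ → σ) (v w : List ℕ) (q : σ) :
    wordAct δ (v ++ w) q = wordAct δ w (wordAct δ v q) :=
  List.foldl_append

/-- `δ(·, v w) = δ(·, w) ∘ δ(·, v)`. [folklore] -/
theorem wordAct_append_eq_comp (δ : σ → ℕ → σ) (v w : List ℕ) :
    wordAct δ (v ++ w) = wordAct δ w ∘ wordAct δ v :=
  funext fun q => wordAct_append δ v w q

end WordAct

section MinImages

variable {σ : Type*} [Fintype σ] [DecidableEq σ]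

/-- `δ(σ, w)`: the image of the whole state set under a word. [cite: Mullner2017, Prop. 2.2 (proof)] -/
def fullImage (δ : σ → ℕ → σ) (w : List ℕ) : Finset σ :=
  univ.image (wordAct δ w)

/-- `δ(σ, v w) = δ(δ(σ, v), w)`. [folklore] -/
theorem fullImage_append (δ : σ → ℕ → σ) (v w : List ℕ) :
    fullImage δ (v ++ w) = (fullImage δ v).image (wordAct δ w) := by
  rw [fullImage, fullImage, wordAct_append_eq_comp, image_image]

/-- `δ(M, w) ⊆ δ(σ, w)`. [folklore] -/
theorem image_subset_fullImage (δ : σ → ℕ → σ) (M : Finset σ) (w : List ℕ) :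
    M.image (wordAct δ w) ⊆ fullImage δ w :=
  image_subset_image (subset_univ M)

/-- `δ(σ, v w) ⊆ δ(σ, w)`. [folklore] -/
theorem fullImage_append_subset (δ : σ → ℕ → σ) (v w : List ℕ) :
    fullImage δ (v ++ w) ⊆ fullImage δ w := by
  rw [fullImage_append]
  exact image_subset_fullImage δ _ w

/-- `n₀(A) = min_w |δ(σ, w)|` (Müllner, proof of Prop. 2.2). [cite: Mullner2017, Prop. 2.2 (proof)] -/
def minRank (δ : σ → ℕ → σ) : ℕ := by
  classical
  exact Nat.find (p := fun n => ∃ w : List ℕ, (fullImage δ w).card = n) ⟨_, [], rfl⟩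

/-- The minimum is attained. [folklore] -/
theorem exists_card_fullImage_eq_minRank (δ : σ → ℕ → σ) :
    ∃ w : List ℕ, (fullImage δ w).card = minRank δ := by
  classical
  exact Nat.find_spec (p := fun n => ∃ w : List ℕ, (fullImage δ w).card = n) ⟨_, [], rfl⟩

/-- Minimality. [folklore] -/
theorem minRank_le_card_fullImage (δ : σ → ℕ → σ) (w : List ℕ) :
    minRank δ ≤ (fullImage δ w).card := by
  classical
  exact Nat.find_min' (p := fun n => ∃ w : List ℕ, (fullImage δ w).card = n) ⟨_, [], rfl⟩ ⟨w, rfl⟩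

/-- `S(A)`: the images `δ(σ, w)` of minimal size `n₀(A)` (Müllner, proof of Prop. 2.2) — the
state set of the naturally induced transducer. [cite: Mullner2017, Prop. 2.2 (proof)] -/
def minImages (δ : σ → ℕ → σ) : Finset (Finset σ) := by
  classical
  exact univ.filter fun M => M.card = minRank δ ∧ ∃ w : List ℕ, fullImage δ w = M

/-- Membership in `S(A)`. [folklore] -/
theorem mem_minImages {δ : σ → ℕ → σ} {M : Finset σ} :
    M ∈ minImages δ ↔ M.card = minRank δ ∧ ∃ w : List ℕ, fullImage δ w = M := by
  classical
  simp [minImages]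

/-- A word realising the minimum gives an element of `S(A)`. [folklore] -/
theorem fullImage_mem_minImages {δ : σ → ℕ → σ} {w : List ℕ}
    (hw : (fullImage δ w).card = minRank δ) : fullImage δ w ∈ minImages δ :=
  mem_minImages.2 ⟨hw, w, rfl⟩

/-- `S(A)` is non-empty. [folklore] -/
theorem minImages_nonempty (δ : σ → ℕ → σ) : (minImages δ).Nonempty := by
  obtain ⟨w, hw⟩ := exists_card_fullImage_eq_minRank δ
  exact ⟨_, fullImage_mem_minImages hw⟩

/-- **Minimal images go to minimal images** (Müllner: "By minimality of `|M|` for `a ∈ Σ` we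
have `δ'(M, a) ∈ S(A)`"): for `M ∈ S(A)` and any word `w`, `δ(M, w) ∈ S(A)`.
[cite: Mullner2017, Prop. 2.2 (proof)] -/
theorem image_mem_minImages {δ : σ → ℕ → σ} {M : Finset σ} (hM : M ∈ minImages δ)
    (w : List ℕ) : M.image (wordAct δ w) ∈ minImages δ := by
  obtain ⟨hcard, v, rfl⟩ := mem_minImages.1 hM
  rw [← fullImage_append]
  refine mem_minImages.2 ⟨le_antisymm ?_ (minRank_le_card_fullImage δ _), v ++ w, rfl⟩
  rw [fullImage_append, ← hcard]
  exact card_image_le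

/-- The size of a minimal image is preserved by every word. [folklore] -/
theorem card_image_wordAct {δ : σ → ℕ → σ} {M : Finset σ} (hM : M ∈ minImages δ)
    (w : List ℕ) : (M.image (wordAct δ w)).card = M.card := by
  rw [(mem_minImages.1 (image_mem_minImages hM w)).1, (mem_minImages.1 hM).1]

/-- **Words act injectively on minimal images** (the basis of the transducer: `δ(·, w)` is a
bijection `M → δ(M, w)`). [cite: Mullner2017, Prop. 2.2 (proof)] -/
theorem injOn_wordAct {δ : σ → ℕ → σ} {M : Finset σ} (hM : M ∈ minImages δ) (w : List ℕ) :
    Set.InjOn (wordAct δ w) M :=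
  card_image_iff.1 (card_image_wordAct hM w)

/-- **A minimising word is synchronizing for the transducer**: if `|δ(σ, w₀)| = n₀(A)` then
`δ(M, w₀) = δ(σ, w₀)` for every `M ∈ S(A)`. [cite: Mullner2017, Def. 2.1 (property 8)] -/
theorem image_eq_fullImage_of_card {δ : σ → ℕ → σ} {M : Finset σ} (hM : M ∈ minImages δ)
    {w₀ : List ℕ} (h₀ : (fullImage δ w₀).card = minRank δ) :
    M.image (wordAct δ w₀) = fullImage δ w₀ :=
  eq_of_subset_of_card_le (image_subset_fullImage δ M w₀)
    (by rw [h₀, card_image_wordAct hM, (mem_minImages.1 hM).1])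

/-- **The transducer is strongly connected**: any minimal image is mapped onto any other by a
suitable word (`w₀ v` with `w₀` minimising and `δ(σ, v)` the target).
[cite: Mullner2017, Def. 2.1 (property 7)] -/
theorem exists_image_eq {δ : σ → ℕ → σ} {M M' : Finset σ} (hM : M ∈ minImages δ)
    (hM' : M' ∈ minImages δ) : ∃ u : List ℕ, M.image (wordAct δ u) = M' := by
  obtain ⟨w₀, h₀⟩ := exists_card_fullImage_eq_minRank δ
  obtain ⟨hcard', v, rfl⟩ := mem_minImages.1 hM'
  refine ⟨w₀ ++ v, eq_of_subset_of_card_le ?_ ?_⟩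
  · rw [wordAct_append_eq_comp, ← image_image, image_eq_fullImage_of_card hM h₀,
      ← fullImage_append]
    exact fullImage_append_subset δ w₀ v
  · rw [card_image_wordAct hM, (mem_minImages.1 hM).1]
    exact hcard'.le

/-- Strong connectivity of an automaton (every state reaches every state by some word).
[cite: Mullner2017, §1.1] -/
def IsStronglyConnected (δ : σ → ℕ → σ) : Prop :=
  ∀ q q' : σ, ∃ u : List ℕ, wordAct δ u q = q'

/-- **`σ` is covered by `S(A)`** when `A` is strongly connected (Müllner, proof of Prop. 2.2:
"Take `q'₁ ∈ Q'` and `M ∈ S(A)` with some `q'₂ ∈ M` … `q'₁ ∈ δ'(M, w) ∈ S(A)`").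
[cite: Mullner2017, Prop. 2.2 (proof)] -/
theorem exists_mem_minImages_mem {δ : σ → ℕ → σ} (hsc : IsStronglyConnected δ) (p : σ) :
    ∃ M ∈ minImages δ, p ∈ M := by
  obtain ⟨M, hM⟩ := minImages_nonempty δ
  have hMne : M.Nonempty := by
    rw [← card_pos, (mem_minImages.1 hM).1]
    have h1 : 0 < (fullImage δ []).card := by
      rw [card_pos, fullImage]
      exact ⟨p, mem_image_of_mem _ (mem_univ p)⟩
    obtain ⟨w, hw⟩ := exists_card_fullImage_eq_minRank δ
    rw [← hw, card_pos, fullImage]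
    exact ⟨wordAct δ w p, mem_image_of_mem _ (mem_univ p)⟩
  obtain ⟨q₂, hq₂⟩ := hMne
  obtain ⟨u, hu⟩ := hsc q₂ p
  exact ⟨_, image_mem_minImages hM u, mem_image.2 ⟨q₂, hq₂, hu⟩⟩

end MinImages

/-! ## The transducer: states `S(A)`, outputs in `Perm (Fin n₀)` -/

section Transducer

variable {σ : Type*} [Fintype σ] [DecidableEq σ]

/-- The state set `Q = S(A)` of the naturally induced transducer, as a subtype.
[cite: Mullner2017, Def. 2.1] -/
abbrev MinImage (δ : σ → ℕ → σ) := {M : Finset σ // M ∈ minImages δ}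

namespace MinImage

variable {δ : σ → ℕ → σ}

/-- The transducer transition `δ(M, w)` (on words). [cite: Mullner2017, Prop. 2.2 (proof)] -/
def next (M : MinImage δ) (w : List ℕ) : MinImage δ :=
  ⟨M.1.image (wordAct δ w), image_mem_minImages M.2 w⟩

/-- Underlying set of `δ(M, w)`. [folklore] -/
@[simp] theorem coe_next (M : MinImage δ) (w : List ℕ) :
    (M.next w).1 = M.1.image (wordAct δ w) := rfl

/-- `δ(M, v w) = δ(δ(M, v), w)`. [folklore] -/
theorem next_append (M : MinImage δ) (v w : List ℕ) : M.next (v ++ w) = (M.next v).next w := by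
  apply Subtype.ext
  simp only [coe_next, wordAct_append_eq_comp, image_image]

/-- A minimising word `w₀` sends every state of the transducer to the same state.
[cite: Mullner2017, Def. 2.1 (property 8)] -/
theorem next_eq_of_card_eq (M M' : MinImage δ) {w₀ : List ℕ}
    (h₀ : (fullImage δ w₀).card = minRank δ) : M.next w₀ = M'.next w₀ := by
  apply Subtype.ext
  simp only [coe_next, image_eq_fullImage_of_card M.2 h₀, image_eq_fullImage_of_card M'.2 h₀]

/-- The enumeration `M ≃ Fin n₀` of a minimal image (Müllner's ordered tuple `q_M`; any fixed
choice — Prop. 2.6 shows the choice is immaterial up to relabelling). [cite: Mullner2017, Prop. 2.2 (proof)] -/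
def enum (M : MinImage δ) : ↥M.1 ≃ Fin (minRank δ) :=
  Finset.equivFinOfCardEq (mem_minImages.1 M.2).1

/-- Enumerations of equal states agree. [folklore] -/
theorem enum_congr {M M' : MinImage δ} (h : M = M') (x : σ) (hx : x ∈ M.1) (hx' : x ∈ M'.1) :
    M.enum ⟨x, hx⟩ = M'.enum ⟨x, hx'⟩ := by
  subst h
  rfl

/-- The action of `w` as a bijection `M ≃ δ(M, w)`. [cite: Mullner2017, Prop. 2.2 (proof)] -/
def actEquiv (M : MinImage δ) (w : List ℕ) : ↥M.1 ≃ ↥(M.next w).1 :=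
  Equiv.ofBijective (fun x => ⟨wordAct δ w x.1, mem_image_of_mem _ x.2⟩)
    ⟨fun x y hxy => Subtype.ext (injOn_wordAct M.2 w x.2 y.2 (congrArg Subtype.val hxy)),
      fun y => by
        obtain ⟨x, hx, hxy⟩ := mem_image.1 y.2
        exact ⟨⟨x, hx⟩, Subtype.ext hxy⟩⟩

/-- Underlying value of `actEquiv`. [folklore] -/
@[simp] theorem coe_actEquiv (M : MinImage δ) (w : List ℕ) (x : ↥M.1) :
    ((M.actEquiv w x : ↥(M.next w).1) : σ) = wordAct δ w x := rfl

/-- **The transducer output** `T(M, w) ∈ Perm (Fin n₀)`: the bijection `δ(·, w) : M → δ(M, w)`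
read through the enumerations (Müllner's `T(q_M, w)`, the product of the `λ`'s along the path;
here defined directly on words). [cite: Mullner2017, Def. 1.7 / Def. 2.1] -/
def T (M : MinImage δ) (w : List ℕ) : Equiv.Perm (Fin (minRank δ)) :=
  (M.enum.symm.trans (M.actEquiv w)).trans (M.next w).enum

/-- `T` on an enumerated state. [folklore] -/
theorem T_apply_enum (M : MinImage δ) (w : List ℕ) (x : ↥M.1) :
    M.T w (M.enum x) = (M.next w).enum (M.actEquiv w x) := by
  rw [T, Equiv.trans_apply, Equiv.trans_apply, Equiv.symm_apply_apply]

/-- **Reconstruction of the automaton from the transducer** (Müllner, Prop. 2.5: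
`δ'(q'₀, w) = π₁(T(q₀, w) · δ(q₀, w))`): for `q' ∈ M`,
`δ(q', w) = enum_{δ(M,w)}⁻¹ (T(M, w)(enum_M q'))`. [cite: Mullner2017, Prop. 2.5] -/
theorem wordAct_eq (M : MinImage δ) (w : List ℕ) (x : ↥M.1) :
    wordAct δ w x = (((M.next w).enum.symm (M.T w (M.enum x)) : ↥(M.next w).1) : σ) := by
  rw [T_apply_enum, Equiv.symm_apply_apply, coe_actEquiv]

/-- **Multiplicativity** (Müllner: `T(q, w₁ w₂) = T(q, w₁) ∘ T(δ(q, w₁), w₂)`; with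
`Equiv.trans` read left to right): `T(M, v w) = T(M, v) ≫ T(δ(M, v), w)`.
[cite: Mullner2017, §1.1 (definition of T(q, w))] -/
theorem T_append (M : MinImage δ) (v w : List ℕ) :
    M.T (v ++ w) = (M.T v).trans ((M.next v).T w) := by
  ext i
  obtain ⟨x, rfl⟩ : ∃ x, M.enum x = i := M.enum.surjective i
  simp only [Equiv.trans_apply, T_apply_enum]
  have h := next_append M v w
  have hmem : wordAct δ (v ++ w) x ∈ ((M.next v).next w).1 := by
    rw [coe_next, coe_next, wordAct_append]
    exact mem_image_of_mem _ (mem_image_of_mem _ x.2)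
  have e1 : M.actEquiv (v ++ w) x = ⟨wordAct δ (v ++ w) x, (M.actEquiv (v ++ w) x).2⟩ := rfl
  have e2 : (⟨wordAct δ (v ++ w) x, hmem⟩ : ↥((M.next v).next w).1) =
      (M.next v).actEquiv w (M.actEquiv v x) := by
    apply Subtype.ext
    show wordAct δ (v ++ w) x = wordAct δ w (wordAct δ v x)
    exact wordAct_append δ v w x
  rw [e1, enum_congr h (wordAct δ (v ++ w) x) (M.actEquiv (v ++ w) x).2 hmem, e2]

/-- `T` of the empty word is the identity. [folklore] -/
theorem T_nil (M : MinImage δ) : M.T [] = 1 := by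
  ext i
  obtain ⟨x, rfl⟩ : ∃ x, M.enum x = i := M.enum.surjective i
  rw [T_apply_enum, Equiv.Perm.one_apply]
  have hid : wordAct δ [] = id := funext fun _ => rfl
  have h : M.next [] = M := Subtype.ext (by rw [coe_next, hid, image_id])
  have e1 : M.actEquiv [] x = ⟨wordAct δ [] x, (M.actEquiv [] x).2⟩ := rfl
  rw [e1, enum_congr h (wordAct δ [] x) (M.actEquiv [] x).2 (by exact x.2)]
  rfl

end MinImage

end Transducer

end Literature.NumberTheory.LFunctions
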